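import Literature.IUT.HodgeTheaters.TemperedCoveringsProp24Sub
import HarnessLib

/-!
# [IUTchI] Prop. 2.4 (i): the tower of levels `Prop24Tower` is INHABITED over every datum — the level-zero
# tower (NV-L5 Prop24Tower, structure non-vacuity; proof-only)

Mochizuki, *Inter-universal Teichmüller theory I*, kurims manuscript (May 2020), §2, proof of Prop. 2.4 (i),
p. 50 l. 27–33: the levels are "finite index characteristic open subgroups `J ⊆ Δ^tp_X`" with the pro-`Σ`
semi-graph of anabelioids `𝔾_J` of the special fibre of the corresponding covering and the specialisation
surjections `J ↠ Π^tp_{𝔾_J}`, `Ĵ ↠ Π̂_{𝔾_J}` [cite: Mochizuki2012, Prop 2.4(i) p.50] (D-0012 claim key; plain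
bookkeeping here, no side taken).  PROOF-ONLY file (seat abc-iut-w5-d119, typer of
`StableCurveTemperedData.Prop24Tower`, p414324; L5-lead RULINGS #27 «NV-L5 row family»; holder of the row
NV-L5 Prop24Tower = abc-iut-w4-d063 g3 / FreeModel tower abc-iut-w4-d012 g3 — this file is the typer's
structural witness offered to that row, not a competing claim).

* `StableCurveTemperedData.Prop24Tower.nonempty_levelZero` — for EVERY `D : StableCurveTemperedData` whose
  specialisation surjection `ρ^tp : Δ^tp_X ↠ Π^tp_𝔾` is continuous, the datum ITSELF is a one-level tower:
  index `PUnit`, `Ĵ := Δ̂_X` (so `J = Δ^tp_X`), `𝔾_J := 𝔾` (the given special-fibre pair `D.graph`),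
  `π^tp := ρ^tp`, `π̂ := ρ̂`, compatibility = the field `ρ_comp` verbatim.  HONEST LABEL: this witnesses the
  STRUCTURE (`Nonempty D.Prop24Tower`, §4(iii) "type inhabited"); of the named hypotheses of
  `prop24i_of_tower`/`prop24i_of_sub`, `LevelsInDelta` and `LevelsNormal` hold for it trivially
  (`levelZero_levelsInDelta`, `levelZero_levelsNormal`), whereas `LevelsCofinal` holds only when `Δ̂_X` has no
  proper open subgroup — the genuine multi-level tower ("by allowing `J` to vary", p. 50 l. 40) needs the
  per-level special-fibre data (abc-iut-w4-d012 g3's `FreeModel.toy` tower; L3 merge otherwise).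
* The one input not recorded by the interface: `Continuous D.ρTp` (the typer's `StableCurveTemperedData`
  carries `ρTp` as a bare homomorphism).

No definition; nothing here bears on [IUTchIII] Cor. 3.12; instantiated ≠ endorsed.
-/

namespace Literature.IUT.HodgeTheaters

namespace StableCurveTemperedData

universe u

variable (D : StableCurveTemperedData.{u})

/-- `ι(Δ^tp_X) ⊆ Δ̂_X`: the level cut out by `Ĵ := Δ̂_X` is all of `Δ^tp_X`.
[cite: Mochizuki2012, Prop 2.4(i) p.50] -/
theorem levelTp_deltaHat_eq_top : D.levelTp D.DeltaHat = ⊤ := by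
  refine top_unique fun x _ => ?_
  rw [mem_levelTp, MonoidHom.mem_ker, ← MonoidHom.comp_apply, D.prHat_comp]
  exact x.2

/-- **NV-L5 `Prop24Tower` (structure): every datum `D` with continuous specialisation surjection
`ρ^tp : Δ^tp_X ↠ Π^tp_𝔾` carries the LEVEL-ZERO tower** `(PUnit; Ĵ := Δ̂_X; 𝔾; ρ^tp; ρ̂; ρ_comp)`, whose one
level IS `Δ̂_X`; in particular `LevelsInDelta` and `LevelsNormal` hold for it.  Label: structural `_model` witness
at level `J = Δ^tp_X` only (see the module docstring for what it does NOT witness).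
[cite: Mochizuki2012, Prop 2.4(i) p.50] -/
theorem Prop24Tower.exists_levelZero (hρ : Continuous D.ρTp) :
    ∃ T : D.Prop24Tower, (∀ i, T.Jhat i = D.DeltaHat) ∧ T.LevelsInDelta ∧ T.LevelsNormal := by
  refine ⟨{ I := PUnit
            Jhat := fun _ => D.DeltaHat
            G := fun _ => D.graph
            πtp := fun _ => D.ρTp.comp ((D.levelTp D.DeltaHat).subtype)
            πtp_continuous := fun _ => hρ.comp continuous_subtype_val
            πtp_surjective := fun _ y => by
              obtain ⟨d, rfl⟩ := D.ρTp_surjective y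
              exact ⟨⟨d, by rw [levelTp_deltaHat_eq_top]; trivial⟩, rfl⟩
            πhat := fun _ => D.ρHat
            comp := fun _ x hx => D.ρ_comp x }, fun _ => rfl, fun _ => le_rfl, fun _ => ?_⟩
  change ((D.DeltaHat).subgroupOf D.DeltaHat).Normal
  rw [Subgroup.subgroupOf_self]
  infer_instance

/-- `Nonempty D.Prop24Tower` for every datum with continuous `ρ^tp` (§4(iii): the structure binder of
`prop24i_of_tower` / `prop24i_of_sub` / `cor24_i'_of_levels_byName` is instantiable). [cite: Mochizuki2012, Prop 2.4(i) p.50] -/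
theorem Prop24Tower.nonempty_levelZero (hρ : Continuous D.ρTp) : Nonempty D.Prop24Tower :=
  let ⟨T, _⟩ := Prop24Tower.exists_levelZero D hρ
  ⟨T⟩

end StableCurveTemperedData

end Literature.IUT.HodgeTheaters
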